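import Summits.NavierStokesRegularity.NavierStokesRegularity.Theses.RossbyDichotomy
import HarnessLib.Audit

/-!
# Birth skeleton (BC3) of the crux `RossbyDichotomy.EllipticMaximaExtend`

(crux item `stmt-NavierStokesRegularity-2920`, rank 2, route `route-NavierStokesRegularity-RossbyDichotomy`;
tree path `Cruxes/EllipticMaximaExtend/Lines/birth.lean`; registrar
`planner-skel-stmt-NavierStokesRegularity-2920-0`, 2026-08-17. The route predates the Lean birth certificate;
this file supplies BC3 retroactively. No `Disproof.lean` / `Negative/` lemma is filed for this crux
(`ledger crux ls`: no workfiles before this registration), so there is no `_false_without_` obstruction to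
honour; the four entries of `ledger negatives --problem NavierStokesRegularity` concern other routes.)

THE CRUX (C1). For `ν > 0` and a classical Navier–Stokes solution on `ℝ³ × [0,T)`, Leray–Hopf from a rapidly
decaying datum: if from some `t₀ < T` on every spatial maximum point `x` of `|ω(t,·)|`, `ω = curl u`, is
ELLIPTIC (`|⟪e, Du(t,x) e⟫| ≤ ½‖ω(t,x)‖` for all unit `e`, Okubo–Weiss / local Rossby number `≤ ½`), then the
solution extends smoothly past `T`.

THE CUT — literally the route header's own NOT-DECOMPOSED-YET plan "C1 ⇐ R1 (local-BMN depletion) + R3 (no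
strain cascade) with glue R1 → R3 → StretchingAtMaxCriterion → C1", with the exterior-strain functional now
TYPED as Constantin's exterior stretching integral at the viscous radius. For a finite-energy field
`u = BS[ω]` one has at every point (Constantin 1994, SIAM Rev. 36, the representation `α(x) =
(3/4π) P.V.∫ D(ŷ, ξ(x+y), ξ(x)) |ω(x+y)| dy/|y|³`, `D(e₁,e₂,e₃) = (e₁·e₃) det(e₁,e₂,e₃)`; multiplied by `|ω(x)|²`):

  `⟪ω(x), Du(x) ω(x)⟫ = (3/4π) · P.V. ∫ ⟪y, ω(x)⟫ ⟪y, ω(x+y) × ω(x)⟫ / |y|⁵ dy`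

(derivation: `u(x) = (4π)⁻¹∫ ω(y) × (x−y)/|x−y|³ dy` — the tree's `Literature.Analysis.FluidPDE.biotSavart`
convention —, `∂_l(z_k/|z|³) = δ_kl/|z|³ − 3 z_k z_l/|z|⁵`, the `δ` term is a triple product with a repeated
vector; checked on a vortex element `ω = e_y` at `R(e_x+e_z)/√2` acting on `ω(0) = e_z`: both sides give
`+3/(8πR³)`). Parallel vorticity does not stretch (`ω(x+y) × ω(x) = 0`): the signed integrand keeps the
cancellations of a columnar (2D-3C) core, which an `∫|ω|/|y|³` majorant would destroy. Cut the `dy`-integral at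
the VISCOUS CORE RADIUS of the maximum, `ℓ(t,x) = (ν/‖ω(t,x)‖)^{1/2}` (the Burgers radius `(ν/γ)^{1/2}` at the
ellipticity threshold `γ = ½ω`, up to `√2`; no free constant):

* `stub_coreDepletion` [XL, OPEN — R1, the card's LOCAL-BMN / self-rotation branch]: under the crux's frame and
  its eventual-ellipticity hypothesis there is `h ∈ L¹(0,T)` with
  `⟪ω, Du ω⟫(t,x) − EXT(t,x) ≤ h(t)‖ω(t,x)‖²` at every maximum point `x` of `|ω(t,·)|`, `t ∈ [0,T)`, where
  `EXT(t,x)` is the exterior stretching integral above over `{|y| ≥ ℓ(t,x)}`: the SELF-STRETCHING OF THE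
  VISCOUS CORE of a rotation-dominated maximum is time-integrably depleted (for `u = BS[ω]` the left side is the
  principal value over the core ball). Why it might fail: kinematically the core term is only `O(‖ω‖_∞)`
  (`|ω(x+y) × ω(x)| ≤ ‖ω‖_∞‖∇ω‖_∞|y|`, parabolic scale `‖∇ω‖ ~ ‖ω‖/ℓ`), i.e. the non-closing `M' ≤ cM²` again;
  integrability is a DYNAMICAL claim (relaxation to a columnar state faster than the core turns over), false
  for strain imposed from infinity (Maekawa–Miura–Prange 2019) — here the strain is not imposed, it is `EXT`.
* `stub_noStrainCascade` [XL, OPEN — R3, the card's finite-energy branch]: same frame ⇒ there is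
  `g ∈ L¹(0,T)` with `EXT(t,x) ≤ g(t)‖ω(t,x)‖²` at every maximum point: a finite-energy flow cannot cascade
  stretching onto its strongest core from OUTSIDE the viscous radius. The far field `{|y| ≥ R}` is energy
  class (`≤ c‖ω(t)‖₂ R^{-3/2}‖ω(t,x)‖²`, integrable in `t` by the energy inequality); the shell
  `ℓ ≤ |y| < R` is where "one scale up Biot–Savart bounds lose a logarithm" (route why-might-fail) — foreseen
  children far/shell, NOT filed (two layers max). Why it might fail: an anti-parallel / sheet-like neighbour
  just outside `ℓ` strains the peak at rate `~‖ω‖_∞` (Hou–Li geometry), and ellipticity AT the peak does not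
  see it.
* `stub_stretchingAtMaxCriterion` [M, provable now — the route's own support item stmt-NavierStokesRegularity-2923,
  BY NAME]: an integrable majorant `g(t)‖ω‖²` of `⟪ω, Du ω⟫` at the vorticity maxima on `[0,T)` gives
  `HasSmoothExtensionPast` (`D⁺‖ω‖_∞ ≤ g‖ω‖_∞` since `ν⟪ω,Δω⟫ ≤ 0` at a maximum of `|ω|`; Grönwall; BKM +
  Tao-2011 persistence, both `_holds` in tree). When 2923 lands, this stub is `StretchingAtMaxCriterion_holds`.

`EllipticMaximaExtend_of : Theses.RossbyDichotomy.EllipticMaximaExtend` is the skeleton theorem (A12 shape: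
the crux BY NAME, no `Prop` hypotheses, the three stubs used by name). The glue is real and CLOSED
(`EllipticMaximaExtend_of_hyps`: the stub statements enter as hypotheses, its conclusion is the crux body
verbatim): take `h` from R1 and `g` from R3, feed `g + h` (integrable on `(0,T)`) to the criterion, using
`⟪ω,Duω⟫ = (⟪ω,Duω⟫ − EXT) + EXT ≤ h‖ω‖² + g‖ω‖² = (g+h)‖ω‖²` at each maximum point.

BC3 PROBES (`bc/probe_stub_*.lean` in the registrar's folder): for each stub `S`, `S → EllipticMaximaExtend`
and `S → NavierStokesRegularity` by `first | exact? | simpa | aesop` FAIL (quoted in `Lines/birth.md`): no stub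
is cheaply the crux or the summit.
-/

noncomputable section

open Set MeasureTheory Filter Topology

namespace Summit.NavierStokesRegularity.NavierStokesRegularity.Cruxes.EllipticMaximaExtend.Birth

set_option linter.unusedVariables false
set_option linter.dupNamespace false

/-- **stub 1 — `stub_coreDepletion` (XL, OPEN; R1 = local-BMN depletion of the viscous core).**
Frame and eventual-ellipticity hypothesis VERBATIM those of the crux; conclusion: an `L¹(0,T)` majorant
`h(t)‖ω(t,x)‖²` of `⟪ω, Du ω⟫(t,x) − EXT(t,x)` at every maximum point `x` of `|curl u(t,·)|`, `t ∈ [0,T)`, where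
`EXT(t,x) = (3/4π) ∫_{|y| ≥ (ν/‖ω(t,x)‖)^{1/2}} ⟪y, ω(t,x)⟫ ⟪y, ω(t,x+y) × ω(t,x)⟫ / |y|⁵ dy` is Constantin's
stretching integral restricted to the exterior of the viscous core ball (written out inline over
`Literature.Analysis.FluidPDE.curl/cross`, Bochner set integral w.r.t. `volume` on `EuclideanSpace ℝ (Fin 3)`). -/
theorem stub_coreDepletion :
    ∀ (ν T : ℝ), 0 < ν → 0 < T →
    ∀ (u : ℝ → EuclideanSpace ℝ (Fin 3) → EuclideanSpace ℝ (Fin 3)) (p : ℝ → EuclideanSpace ℝ (Fin 3) → ℝ),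
      Literature.Analysis.FluidPDE.IsClassicalNSSolutionOn (Set.Ico 0 T) ν 0 u p →
      Literature.Analysis.FluidPDE.IsLerayHopfOn T ν 0 (u 0) u →
      Literature.Analysis.FluidPDE.HasRapidSpatialDecay (u 0) →
      (∃ t₀ ∈ Set.Ico 0 T, ∀ t ∈ Set.Ico t₀ T, ∀ x : EuclideanSpace ℝ (Fin 3),
        (∀ y, ‖Literature.Analysis.FluidPDE.curl (u t) y‖ ≤ ‖Literature.Analysis.FluidPDE.curl (u t) x‖) →
        ∀ e : EuclideanSpace ℝ (Fin 3), ‖e‖ = 1 →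
          |inner ℝ e (fderiv ℝ (u t) x e)| ≤ (1 / 2 : ℝ) * ‖Literature.Analysis.FluidPDE.curl (u t) x‖) →
      ∃ h : ℝ → ℝ, MeasureTheory.IntegrableOn h (Set.Ioo 0 T) ∧
        ∀ t ∈ Set.Ico 0 T, ∀ x : EuclideanSpace ℝ (Fin 3),
          (∀ y, ‖Literature.Analysis.FluidPDE.curl (u t) y‖ ≤ ‖Literature.Analysis.FluidPDE.curl (u t) x‖) →
          inner ℝ (Literature.Analysis.FluidPDE.curl (u t) x)
              (fderiv ℝ (u t) x (Literature.Analysis.FluidPDE.curl (u t) x))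
            - (3 / (4 * Real.pi)) *
              (∫ y in (Metric.ball (0 : EuclideanSpace ℝ (Fin 3))
                  (Real.sqrt (ν / ‖Literature.Analysis.FluidPDE.curl (u t) x‖)))ᶜ,
                inner ℝ y (Literature.Analysis.FluidPDE.curl (u t) x) *
                  inner ℝ y (Literature.Analysis.FluidPDE.cross
                    (Literature.Analysis.FluidPDE.curl (u t) (x + y)) (Literature.Analysis.FluidPDE.curl (u t) x)) /
                  ‖y‖ ^ 5)
            ≤ h t * ‖Literature.Analysis.FluidPDE.curl (u t) x‖ ^ 2 := by
  sorry

/-- **stub 2 — `stub_noStrainCascade` (XL, OPEN; R3 = no strain cascade onto the strongest core).**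
Same frame and eventual-ellipticity hypothesis; conclusion: an `L¹(0,T)` majorant `g(t)‖ω(t,x)‖²` of the
exterior stretching integral `EXT(t,x)` (vorticity OUTSIDE the viscous core radius `(ν/‖ω(t,x)‖)^{1/2}` acting on
the maximum) at every maximum point, `t ∈ [0,T)`. Far field = energy class; the shell one scale up is the
content. -/
theorem stub_noStrainCascade :
    ∀ (ν T : ℝ), 0 < ν → 0 < T →
    ∀ (u : ℝ → EuclideanSpace ℝ (Fin 3) → EuclideanSpace ℝ (Fin 3)) (p : ℝ → EuclideanSpace ℝ (Fin 3) → ℝ),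
      Literature.Analysis.FluidPDE.IsClassicalNSSolutionOn (Set.Ico 0 T) ν 0 u p →
      Literature.Analysis.FluidPDE.IsLerayHopfOn T ν 0 (u 0) u →
      Literature.Analysis.FluidPDE.HasRapidSpatialDecay (u 0) →
      (∃ t₀ ∈ Set.Ico 0 T, ∀ t ∈ Set.Ico t₀ T, ∀ x : EuclideanSpace ℝ (Fin 3),
        (∀ y, ‖Literature.Analysis.FluidPDE.curl (u t) y‖ ≤ ‖Literature.Analysis.FluidPDE.curl (u t) x‖) →
        ∀ e : EuclideanSpace ℝ (Fin 3), ‖e‖ = 1 →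
          |inner ℝ e (fderiv ℝ (u t) x e)| ≤ (1 / 2 : ℝ) * ‖Literature.Analysis.FluidPDE.curl (u t) x‖) →
      ∃ g : ℝ → ℝ, MeasureTheory.IntegrableOn g (Set.Ioo 0 T) ∧
        ∀ t ∈ Set.Ico 0 T, ∀ x : EuclideanSpace ℝ (Fin 3),
          (∀ y, ‖Literature.Analysis.FluidPDE.curl (u t) y‖ ≤ ‖Literature.Analysis.FluidPDE.curl (u t) x‖) →
          (3 / (4 * Real.pi)) *
              (∫ y in (Metric.ball (0 : EuclideanSpace ℝ (Fin 3))
                  (Real.sqrt (ν / ‖Literature.Analysis.FluidPDE.curl (u t) x‖)))ᶜ,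
                inner ℝ y (Literature.Analysis.FluidPDE.curl (u t) x) *
                  inner ℝ y (Literature.Analysis.FluidPDE.cross
                    (Literature.Analysis.FluidPDE.curl (u t) (x + y)) (Literature.Analysis.FluidPDE.curl (u t) x)) /
                  ‖y‖ ^ 5)
            ≤ g t * ‖Literature.Analysis.FluidPDE.curl (u t) x‖ ^ 2 := by
  sorry

/-- **stub 3 — `stub_stretchingAtMaxCriterion` (M, provable now; the route's support item
stmt-NavierStokesRegularity-2923 BY NAME).** Stretching-at-the-maximum continuation criterion: an integrable
majorant `g(t)‖ω‖²` of `⟪ω, Du ω⟫` at the vorticity maxima on `[0,T)` ⇒ `HasSmoothExtensionPast ν 0 u T`. -/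
theorem stub_stretchingAtMaxCriterion : Theses.RossbyDichotomy.StretchingAtMaxCriterion := by
  sorry

/-- **Birth composition, CLOSED form.** The three stub STATEMENTS imply the crux (its body verbatim; the by-name
form is `EllipticMaximaExtend_of` below). Real glue: `G := g + h` is integrable on `(0,T)` and
`⟪ω,Duω⟫ = (⟪ω,Duω⟫ − EXT) + EXT ≤ h‖ω‖² + g‖ω‖² = (g + h)‖ω‖²` at every maximum point; the criterion concludes. -/
theorem EllipticMaximaExtend_of_hyps
    (hR1 : ∀ (ν T : ℝ), 0 < ν → 0 < T →
    ∀ (u : ℝ → EuclideanSpace ℝ (Fin 3) → EuclideanSpace ℝ (Fin 3)) (p : ℝ → EuclideanSpace ℝ (Fin 3) → ℝ),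
      Literature.Analysis.FluidPDE.IsClassicalNSSolutionOn (Set.Ico 0 T) ν 0 u p →
      Literature.Analysis.FluidPDE.IsLerayHopfOn T ν 0 (u 0) u →
      Literature.Analysis.FluidPDE.HasRapidSpatialDecay (u 0) →
      (∃ t₀ ∈ Set.Ico 0 T, ∀ t ∈ Set.Ico t₀ T, ∀ x : EuclideanSpace ℝ (Fin 3),
        (∀ y, ‖Literature.Analysis.FluidPDE.curl (u t) y‖ ≤ ‖Literature.Analysis.FluidPDE.curl (u t) x‖) →
        ∀ e : EuclideanSpace ℝ (Fin 3), ‖e‖ = 1 →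
          |inner ℝ e (fderiv ℝ (u t) x e)| ≤ (1 / 2 : ℝ) * ‖Literature.Analysis.FluidPDE.curl (u t) x‖) →
      ∃ h : ℝ → ℝ, MeasureTheory.IntegrableOn h (Set.Ioo 0 T) ∧
        ∀ t ∈ Set.Ico 0 T, ∀ x : EuclideanSpace ℝ (Fin 3),
          (∀ y, ‖Literature.Analysis.FluidPDE.curl (u t) y‖ ≤ ‖Literature.Analysis.FluidPDE.curl (u t) x‖) →
          inner ℝ (Literature.Analysis.FluidPDE.curl (u t) x)
              (fderiv ℝ (u t) x (Literature.Analysis.FluidPDE.curl (u t) x))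
            - (3 / (4 * Real.pi)) *
              (∫ y in (Metric.ball (0 : EuclideanSpace ℝ (Fin 3))
                  (Real.sqrt (ν / ‖Literature.Analysis.FluidPDE.curl (u t) x‖)))ᶜ,
                inner ℝ y (Literature.Analysis.FluidPDE.curl (u t) x) *
                  inner ℝ y (Literature.Analysis.FluidPDE.cross
                    (Literature.Analysis.FluidPDE.curl (u t) (x + y)) (Literature.Analysis.FluidPDE.curl (u t) x)) /
                  ‖y‖ ^ 5)
            ≤ h t * ‖Literature.Analysis.FluidPDE.curl (u t) x‖ ^ 2)
    (hR3 : ∀ (ν T : ℝ), 0 < ν → 0 < T →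
    ∀ (u : ℝ → EuclideanSpace ℝ (Fin 3) → EuclideanSpace ℝ (Fin 3)) (p : ℝ → EuclideanSpace ℝ (Fin 3) → ℝ),
      Literature.Analysis.FluidPDE.IsClassicalNSSolutionOn (Set.Ico 0 T) ν 0 u p →
      Literature.Analysis.FluidPDE.IsLerayHopfOn T ν 0 (u 0) u →
      Literature.Analysis.FluidPDE.HasRapidSpatialDecay (u 0) →
      (∃ t₀ ∈ Set.Ico 0 T, ∀ t ∈ Set.Ico t₀ T, ∀ x : EuclideanSpace ℝ (Fin 3),
        (∀ y, ‖Literature.Analysis.FluidPDE.curl (u t) y‖ ≤ ‖Literature.Analysis.FluidPDE.curl (u t) x‖) →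
        ∀ e : EuclideanSpace ℝ (Fin 3), ‖e‖ = 1 →
          |inner ℝ e (fderiv ℝ (u t) x e)| ≤ (1 / 2 : ℝ) * ‖Literature.Analysis.FluidPDE.curl (u t) x‖) →
      ∃ g : ℝ → ℝ, MeasureTheory.IntegrableOn g (Set.Ioo 0 T) ∧
        ∀ t ∈ Set.Ico 0 T, ∀ x : EuclideanSpace ℝ (Fin 3),
          (∀ y, ‖Literature.Analysis.FluidPDE.curl (u t) y‖ ≤ ‖Literature.Analysis.FluidPDE.curl (u t) x‖) →
          (3 / (4 * Real.pi)) *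
              (∫ y in (Metric.ball (0 : EuclideanSpace ℝ (Fin 3))
                  (Real.sqrt (ν / ‖Literature.Analysis.FluidPDE.curl (u t) x‖)))ᶜ,
                inner ℝ y (Literature.Analysis.FluidPDE.curl (u t) x) *
                  inner ℝ y (Literature.Analysis.FluidPDE.cross
                    (Literature.Analysis.FluidPDE.curl (u t) (x + y)) (Literature.Analysis.FluidPDE.curl (u t) x)) /
                  ‖y‖ ^ 5)
            ≤ g t * ‖Literature.Analysis.FluidPDE.curl (u t) x‖ ^ 2)
    (hcrit : Theses.RossbyDichotomy.StretchingAtMaxCriterion) :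
    ∀ (ν T : ℝ), 0 < ν → 0 < T →
    ∀ (u : ℝ → EuclideanSpace ℝ (Fin 3) → EuclideanSpace ℝ (Fin 3)) (p : ℝ → EuclideanSpace ℝ (Fin 3) → ℝ),
      Literature.Analysis.FluidPDE.IsClassicalNSSolutionOn (Set.Ico 0 T) ν 0 u p →
      Literature.Analysis.FluidPDE.IsLerayHopfOn T ν 0 (u 0) u →
      Literature.Analysis.FluidPDE.HasRapidSpatialDecay (u 0) →
      (∃ t₀ ∈ Set.Ico 0 T, ∀ t ∈ Set.Ico t₀ T, ∀ x : EuclideanSpace ℝ (Fin 3),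
        (∀ y, ‖Literature.Analysis.FluidPDE.curl (u t) y‖ ≤ ‖Literature.Analysis.FluidPDE.curl (u t) x‖) →
        ∀ e : EuclideanSpace ℝ (Fin 3), ‖e‖ = 1 →
          |inner ℝ e (fderiv ℝ (u t) x e)| ≤ (1 / 2 : ℝ) * ‖Literature.Analysis.FluidPDE.curl (u t) x‖) →
      Literature.Analysis.FluidPDE.HasSmoothExtensionPast ν 0 u T := by
  intro ν T hν hT u p hcl hLH hdec hell
  obtain ⟨h, hh, hcore⟩ := hR1 ν T hν hT u p hcl hLH hdec hell
  obtain ⟨g, hg, hext⟩ := hR3 ν T hν hT u p hcl hLH hdec hell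
  refine hcrit ν T hν hT u p hcl hLH hdec ⟨fun t => g t + h t, hg.add hh, ?_⟩
  intro t ht x hx
  have h1 := hcore t ht x hx
  have h3 := hext t ht x hx
  -- abbreviate the stretching `S`, the exterior stretching `E` and the squared peak vorticity `N`
  set S := inner ℝ (Literature.Analysis.FluidPDE.curl (u t) x)
      (fderiv ℝ (u t) x (Literature.Analysis.FluidPDE.curl (u t) x)) with hS
  set E := (3 / (4 * Real.pi)) *
      (∫ y in (Metric.ball (0 : EuclideanSpace ℝ (Fin 3))
          (Real.sqrt (ν / ‖Literature.Analysis.FluidPDE.curl (u t) x‖)))ᶜ,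
        inner ℝ y (Literature.Analysis.FluidPDE.curl (u t) x) *
          inner ℝ y (Literature.Analysis.FluidPDE.cross
            (Literature.Analysis.FluidPDE.curl (u t) (x + y)) (Literature.Analysis.FluidPDE.curl (u t) x)) /
          ‖y‖ ^ 5) with hE
  set N := ‖Literature.Analysis.FluidPDE.curl (u t) x‖ ^ 2 with hN
  calc S = (S - E) + E := by ring
    _ ≤ h t * N + g t * N := add_le_add h1 h3
    _ = (g t + h t) * N := by ring

/-- **Birth composition (the skeleton theorem, A12 shape).** The crux BY NAME from the three registered stubs,
used by name; all glue is in the closed `EllipticMaximaExtend_of_hyps`. -/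
theorem EllipticMaximaExtend_of : Theses.RossbyDichotomy.EllipticMaximaExtend :=
  EllipticMaximaExtend_of_hyps stub_coreDepletion stub_noStrainCascade stub_stretchingAtMaxCriterion

end Summit.NavierStokesRegularity.NavierStokesRegularity.Cruxes.EllipticMaximaExtend.Birth
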